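import Literature.GroupTheory.CombinatorialGroupTheory.FreeFactorFibredTwist
import HarnessLib

/-!
# The fibred twist with NONABELIAN fibre: homomorphisms of a free factor's level extend to the whole level

Topic `Literature/GroupTheory/CombinatorialGroupTheory`; theorems only, Mathlib-only; sibling of
`FreeFactorFibredTwist.lean` (abc-iut-f-166), whose FIBRED TWIST is repeated VERBATIM with a fibre that is
an arbitrary group `H` instead of an abelian one (the cocycle acts on the fibre by LEFT multiplication, the
homomorphism property of `χ` comes from commutation with RIGHT translation, and the twisting element of a
conjugate is only determined up to conjugation in `H`).  Serre, *Trees*, I §5.5 Thm. 14 (subgroups of free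
products; here its elementary permutation-representation shadow for a FREE factor)
[cite: SerreTrees1980, I §5.5 Thm. 14]; [CombGC] Prop. 1.2, proof p. 9 ("gluing together appropriate finite
étale coverings of the anabelioids `G_v`, `G_e`") for the consumer [cite: MochizukiCombGC2007, Prop 1.2 proof p.9].

**Setting.**  `Γ` free with basis `b`, `S ⊆ β`, `Γ_S = ⟨b(S)⟩`, `N ⊴ Γ` any normal subgroup,
`B = Γ_S ∩ N`, `H` ANY group, `φ : B → H` a homomorphism, `f ∈ Γ`.

**Theorem `exists_hom_extension_of_freeFactor`.**  There are a homomorphism `χ : N → H` and `h ∈ H` with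
`χ(f x f⁻¹) = h φ(x) h⁻¹` for `x ∈ B` and `χ(g x g⁻¹) = 1` for `x ∈ B` whenever `f⁻¹ g ∉ Γ_S·N`.
(Coset-graph reading: the covering of the level defined by `φ` over ONE vertex above the factor and
trivial over all the other vertices above it — for NONABELIAN monodromy, which is what separating the
two branches of a node of a component without cusps requires: the loop around a single puncture of a
once-punctured surface is a product of commutators.)  Construction: `Q = Γ/N`, `Ā` the image of `Γ_S`,
`O = {q : q·π(f) ∈ Ā}`, `s` a section of `O` in `Γ_S`, cocycle `c(a, q) = φ(s(aq)⁻¹ a s(q))` on `O` (`1`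
off `O`); `b_j`, `j ∈ S`, acts on `Q × H` by `(q, m) ↦ (b_j q, c(b_j, q)·m)`, the other letters plainly;
`χ(n) = pr₂(ρ(n)(1, 1))`.

**Corollary `exists_normal_separating_of_freeFactor_hom`**: for `φ : B → H` into a FINITE group and `f`:
`U ⊴ N` with `N/U ↪ H` (so `[N : U] ∣ |H|`), `U ⊇ g B g⁻¹` whenever `f⁻¹ g ∉ Γ_S·N`, and
`f x f⁻¹ ∈ U ↔ φ(x) = 1` for `x ∈ B` — the level-`N` covering is `φ` over the vertex of `f` and trivial over
the other vertices above the factor.  Elementary; 0 definitions; nothing here concerns [IUTchIII].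
-/

namespace Literature.GroupTheory.CombinatorialGroupTheory

namespace FreeFactorFibredTwistNonabelian

open scoped Pointwise
open FreeFactorFibredTwist (lift_apply_basis mem_closure_range_basis normal_coe_mul_comm)

variable {Γ : Type*} [Group Γ] {β : Type*}

/-- **The fibred twist with nonabelian fibre.**  For a free group `Γ` with basis `b`, `S ⊆ β`,
`Γ_S = ⟨b(S)⟩`, a normal subgroup `N ⊴ Γ`, ANY group `H`, a homomorphism `φ : Γ_S ∩ N → H` and `f ∈ Γ`:
there are `χ : N → H` and `h ∈ H` with `χ(f x f⁻¹) = h φ(x) h⁻¹` on `Γ_S ∩ N` and `χ(g x g⁻¹) = 1` for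
`x ∈ Γ_S ∩ N` whenever `f⁻¹ g ∉ Γ_S · N`. [cite: SerreTrees1980, I §5.5 Thm. 14] -/
theorem exists_hom_extension_of_freeFactor (b : FreeGroupBasis β Γ) (S : Set β)
    (A : Subgroup Γ) (hA : A = Subgroup.closure (b '' S))
    (N : Subgroup Γ) [hN : N.Normal] {H : Type*} [Group H] (φ : ↥(A ⊓ N) →* H) (f : Γ) :
    ∃ (χ : N →* H) (h : H),
      (∀ (x : Γ) (hx : x ∈ A ⊓ N), χ ⟨f * x * f⁻¹, hN.conj_mem x hx.2 f⟩ = h * φ ⟨x, hx⟩ * h⁻¹) ∧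
      ∀ g : Γ, f⁻¹ * g ∉ (A : Set Γ) * (N : Set Γ) →
        ∀ (x : Γ) (hx : x ∈ A ⊓ N), χ ⟨g * x * g⁻¹, hN.conj_mem x hx.2 g⟩ = 1 := by
  classical
  -- the quotient `Q = Γ/N`, the image `Ā` of the factor, the orbit `O` of `π(f⁻¹)`
  set π : Γ →* Γ ⧸ N := QuotientGroup.mk' N with hπ
  have hπN : ∀ {x : Γ}, π x = 1 ↔ x ∈ N := fun {x} => by
    rw [hπ, QuotientGroup.mk'_apply, QuotientGroup.eq_one_iff]
  set Abar : Subgroup (Γ ⧸ N) := A.map π with hAbar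
  have hAN : ∀ {x : Γ}, π x ∈ Abar ↔ x ∈ (A : Set Γ) * (N : Set Γ) := fun {x} => by
    have hk : A ⊔ N = Abar.comap π := by
      rw [hAbar, Subgroup.comap_map_eq, hπ, QuotientGroup.ker_mk']
    rw [← Subgroup.mul_normal A N, SetLike.mem_coe, hk, Subgroup.mem_comap]
  let O : Set (Γ ⧸ N) := {q | q * π f ∈ Abar}
  have hO_iff : ∀ q, q ∈ O ↔ q * π f ∈ Abar := fun q => Iff.rfl
  have hO_mul : ∀ {a : Γ}, a ∈ A → ∀ q, π a * q ∈ O ↔ q ∈ O := by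
    intro a ha q
    rw [hO_iff, hO_iff, mul_assoc]
    exact Subgroup.mul_mem_cancel_left _ (Subgroup.mem_map_of_mem π ha)
  -- a section of the orbit with values in `Γ_S`: `π (s q) = q * π f` for `q ∈ O`
  have hsec : ∀ q ∈ O, ∃ a ∈ A, π a = q * π f := fun q hq => Subgroup.mem_map.mp hq
  let s : Γ ⧸ N → Γ := fun q => if hq : q ∈ O then (hsec q hq).choose else 1
  have hsA : ∀ {q}, q ∈ O → s q ∈ A := fun {q} hq => by
    simp only [s, dif_pos hq]; exact (hsec q hq).choose_spec.1
  have hsπ : ∀ {q}, q ∈ O → π (s q) = q * π f := fun {q} hq => by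
    simp only [s, dif_pos hq]; exact (hsec q hq).choose_spec.2
  -- transition elements and the cocycle `c`
  have ht : ∀ {a : Γ} {q : Γ ⧸ N}, a ∈ A → q ∈ O → (s (π a * q))⁻¹ * a * s q ∈ A ⊓ N := by
    intro a q ha hq
    refine Subgroup.mem_inf.mpr
      ⟨A.mul_mem (A.mul_mem (A.inv_mem (hsA ((hO_mul ha q).mpr hq))) ha) (hsA hq), ?_⟩
    rw [← hπN, map_mul, map_mul, map_inv, hsπ ((hO_mul ha q).mpr hq), hsπ hq]
    group
  let c : Γ → Γ ⧸ N → H := fun a q =>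
    if h : a ∈ A ∧ q ∈ O then φ ⟨(s (π a * q))⁻¹ * a * s q, ht h.1 h.2⟩ else 1
  have hc_of_pos : ∀ {a q} (ha : a ∈ A) (hq : q ∈ O),
      c a q = φ ⟨(s (π a * q))⁻¹ * a * s q, ht ha hq⟩ := fun {a q} ha hq => by
    simp only [c, dif_pos (And.intro ha hq)]
  have hc_of_not : ∀ {a q}, q ∉ O → c a q = 1 := fun {a q} hq =>
    dif_neg (show ¬ (a ∈ A ∧ q ∈ O) from fun h => hq h.2)
  have hc_cocycle : ∀ {a a' : Γ}, a ∈ A → a' ∈ A → ∀ q,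
      c (a * a') q = c a (π a' * q) * c a' q := by
    intro a a' ha ha' q
    by_cases hq : q ∈ O
    · have hq' : π a' * q ∈ O := (hO_mul ha' q).mpr hq
      rw [hc_of_pos (A.mul_mem ha ha') hq, hc_of_pos ha hq', hc_of_pos ha' hq, ← map_mul]
      congr 1
      apply Subtype.ext
      change (s (π (a * a') * q))⁻¹ * (a * a') * s q =
        (s (π a * (π a' * q)))⁻¹ * a * s (π a' * q) * ((s (π a' * q))⁻¹ * a' * s q)
      rw [map_mul, mul_assoc (π a)]
      group
    · have hq' : π a' * q ∉ O := fun h => hq ((hO_mul ha' q).mp h)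
      rw [hc_of_not hq, hc_of_not hq', hc_of_not hq, mul_one]
  have hc_one : ∀ q, c 1 q = 1 := fun q => by
    have h := hc_cocycle A.one_mem A.one_mem q
    rw [mul_one, map_one, one_mul] at h
    exact mul_eq_right.mp h.symm
  -- the twisted action of `Γ_S` on `X = Q × H` (LEFT multiplication in the fibre)
  let T : Γ → (Γ ⧸ N) × H → (Γ ⧸ N) × H := fun a x => (π a * x.1, c a x.1 * x.2)
  have hT : ∀ a q m₀, T a (q, m₀) = (π a * q, c a q * m₀) := fun _ _ _ => rfl
  have hT_mul : ∀ {a a' : Γ}, a ∈ A → a' ∈ A → ∀ x, T (a * a') x = T a (T a' x) := by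
    rintro a a' ha ha' ⟨q, m₀⟩
    change (π (a * a') * q, c (a * a') q * m₀) = (π a * (π a' * q), c a (π a' * q) * (c a' q * m₀))
    rw [map_mul, mul_assoc (π a) (π a') q, hc_cocycle ha ha', mul_assoc]
  have hT_one : ∀ x, T 1 x = x := by
    rintro ⟨q, m₀⟩
    rw [hT, map_one, one_mul, hc_one, one_mul]
  let perm : ∀ a : Γ, a ∈ A → Equiv.Perm ((Γ ⧸ N) × H) := fun a ha =>
    { toFun := T a
      invFun := T a⁻¹
      left_inv := fun x => by
        rw [← hT_mul (A.inv_mem ha) ha, inv_mul_cancel, hT_one]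
      right_inv := fun x => by
        rw [← hT_mul ha (A.inv_mem ha), mul_inv_cancel, hT_one] }
  have hperm : ∀ {a} (ha : a ∈ A) x, perm a ha x = T a x := fun _ _ => rfl
  -- the untwisted action of the remaining basis letters
  let plain : Γ → Equiv.Perm ((Γ ⧸ N) × H) := fun g =>
    (Equiv.mulLeft (π g)).prodCongr (Equiv.refl H)
  have hplain : ∀ g q m₀, plain g (q, m₀) = (π g * q, m₀) := fun _ _ _ => rfl
  -- the `Γ`-action, basis letter by basis letter
  have hbS : ∀ {i}, i ∈ S → b i ∈ A := fun {i} hi => by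
    rw [hA]; exact Subgroup.subset_closure (Set.mem_image_of_mem b hi)
  let ρ : Γ →* Equiv.Perm ((Γ ⧸ N) × H) :=
    b.lift fun i => if hi : i ∈ S then perm (b i) (hbS hi) else plain (b i)
  have hρ_basis : ∀ i, ρ (b i) = if hi : i ∈ S then perm (b i) (hbS hi) else plain (b i) :=
    fun i => lift_apply_basis b _ i
  -- (1) on the factor, `ρ` is the twisted action
  have hρA : ∀ (a : Γ) (ha : a ∈ A) (x : (Γ ⧸ N) × H), ρ a x = T a x := by
    have hmemA : ∀ {a}, a ∈ Subgroup.closure (b '' S) → a ∈ A := fun h => by rw [hA]; exact h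
    intro a ha
    have ha' : a ∈ Subgroup.closure (b '' S) := by rw [← hA]; exact ha
    refine Subgroup.closure_induction (p := fun a _ => ∀ x, ρ a x = T a x) ?_ ?_ ?_ ?_ ha'
    · rintro _ ⟨i, hi, rfl⟩ x
      rw [hρ_basis i, dif_pos hi, hperm (hbS hi)]
    · intro x
      rw [map_one, hT_one, Equiv.Perm.one_apply]
    · intro a a' ha ha' iha iha' x
      rw [map_mul, Equiv.Perm.mul_apply, iha', iha, hT_mul (hmemA ha) (hmemA ha')]
    · intro a ha iha x
      have h := iha (ρ a⁻¹ x)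
      rw [← Equiv.Perm.mul_apply, ← map_mul, mul_inv_cancel, map_one, Equiv.Perm.one_apply] at h
      calc ρ a⁻¹ x = T a⁻¹ (T a (ρ a⁻¹ x)) := by
              rw [← hT_mul (A.inv_mem (hmemA ha)) (hmemA ha), inv_mul_cancel, hT_one]
        _ = T a⁻¹ x := by rw [← h]
  -- (2) `ρ` covers left translation on `Q`; (3) `ρ` commutes with right translation by `H`
  have hρ_fst_snd : ∀ g : Γ, (∀ (q : Γ ⧸ N) (m₀ : H), (ρ g (q, m₀)).1 = π g * q) ∧
      ∀ (q : Γ ⧸ N) (m₀ m : H), ρ g (q, m₀ * m) = ((ρ g (q, m₀)).1, (ρ g (q, m₀)).2 * m) := by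
    intro g
    refine Subgroup.closure_induction (p := fun g _ => (∀ (q : Γ ⧸ N) (m₀ : H),
        (ρ g (q, m₀)).1 = π g * q) ∧
      ∀ (q : Γ ⧸ N) (m₀ m : H), ρ g (q, m₀ * m) = ((ρ g (q, m₀)).1, (ρ g (q, m₀)).2 * m))
      ?_ ?_ ?_ ?_ (mem_closure_range_basis b g)
    · rintro _ ⟨i, rfl⟩
      by_cases hi : i ∈ S
      · refine ⟨fun q m₀ => ?_, fun q m₀ m => ?_⟩
        · rw [hρ_basis i, dif_pos hi, hperm (hbS hi), hT]
        · rw [hρ_basis i, dif_pos hi, hperm (hbS hi), hperm (hbS hi), hT, hT, mul_assoc]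
      · refine ⟨fun q m₀ => ?_, fun q m₀ m => ?_⟩
        · rw [hρ_basis i, dif_neg hi, hplain]
        · rw [hρ_basis i, dif_neg hi, hplain, hplain]
    · refine ⟨fun q m₀ => ?_, fun q m₀ m => ?_⟩
      · rw [map_one, Equiv.Perm.one_apply, map_one, one_mul]
      · rw [map_one, Equiv.Perm.one_apply, Equiv.Perm.one_apply]
    · rintro g g' - - ⟨ih₁, ih₂⟩ ⟨ih₁', ih₂'⟩
      refine ⟨fun q m₀ => ?_, fun q m₀ m => ?_⟩
      · rw [map_mul, Equiv.Perm.mul_apply, map_mul, mul_assoc, ← ih₁' q m₀]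
        obtain ⟨q', m'⟩ := ρ g' (q, m₀)
        exact ih₁ q' m'
      · rw [map_mul, Equiv.Perm.mul_apply, Equiv.Perm.mul_apply, ih₂']
        obtain ⟨q', m'⟩ := ρ g' (q, m₀)
        exact ih₂ q' m' m
    · rintro g - ⟨ih₁, ih₂⟩
      have hinv : ∀ (q : Γ ⧸ N) (m₀ : H), ρ g (ρ g⁻¹ (q, m₀)) = (q, m₀) := fun q m₀ => by
        rw [← Equiv.Perm.mul_apply, ← map_mul, mul_inv_cancel, map_one, Equiv.Perm.one_apply]
      refine ⟨fun q m₀ => ?_, fun q m₀ m => ?_⟩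
      · have h1 := ih₁ (ρ g⁻¹ (q, m₀)).1 (ρ g⁻¹ (q, m₀)).2
        rw [Prod.mk.eta, hinv] at h1
        rw [show π g⁻¹ = (π g)⁻¹ from map_inv π g, eq_inv_mul_iff_mul_eq]
        exact h1.symm
      · have h2 := ih₂ (ρ g⁻¹ (q, m₀)).1 (ρ g⁻¹ (q, m₀)).2 m
        rw [Prod.mk.eta, hinv] at h2
        have h3 := congrArg (ρ g⁻¹) h2
        rw [← Equiv.Perm.mul_apply, ← map_mul, inv_mul_cancel, map_one, Equiv.Perm.one_apply] at h3
        exact h3.symm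
  have hρ_fst : ∀ (g : Γ) (q : Γ ⧸ N) (m₀ : H), (ρ g (q, m₀)).1 = π g * q :=
    fun g => (hρ_fst_snd g).1
  have hρ_snd : ∀ (g : Γ) (q : Γ ⧸ N) (m₀ m : H),
      ρ g (q, m₀ * m) = ((ρ g (q, m₀)).1, (ρ g (q, m₀)).2 * m) := fun g => (hρ_fst_snd g).2
  -- elements of `N` fix the first coordinate
  have hρN : ∀ {n : Γ}, n ∈ N → ∀ (q : Γ ⧸ N) (m₀ : H), ρ n (q, m₀) = (q, (ρ n (q, m₀)).2) := by
    intro n hn q m₀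
    exact Prod.ext (by rw [hρ_fst, hπN.mpr hn, one_mul]) rfl
  -- the homomorphism `χ(n) = pr₂ (ρ n (1, 1))`
  let χ : N →* H :=
    { toFun := fun n => (ρ (n : Γ) ((1 : Γ ⧸ N), (1 : H))).2
      map_one' := by
        change (ρ ((1 : N) : Γ) ((1 : Γ ⧸ N), (1 : H))).2 = 1
        rw [OneMemClass.coe_one, map_one, Equiv.Perm.one_apply]
      map_mul' := fun n n' => by
        change (ρ ((n : Γ) * n') ((1 : Γ ⧸ N), (1 : H))).2 =
          (ρ (n : Γ) ((1 : Γ ⧸ N), (1 : H))).2 * (ρ (n' : Γ) ((1 : Γ ⧸ N), (1 : H))).2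
        have e' : ρ (n' : Γ) ((1 : Γ ⧸ N), (1 : H)) = (1, (ρ (n' : Γ) ((1 : Γ ⧸ N), (1 : H))).2) :=
          hρN n'.2 1 1
        have h := hρ_snd (n : Γ) 1 1 (ρ (n' : Γ) ((1 : Γ ⧸ N), (1 : H))).2
        rw [one_mul] at h
        rw [map_mul ρ, Equiv.Perm.mul_apply, e', h] }
  have hχ : ∀ (n : Γ) (hn : n ∈ N), χ ⟨n, hn⟩ = (ρ n ((1 : Γ ⧸ N), (1 : H))).2 := fun _ _ => rfl
  -- `χ (g x g⁻¹) = y₂⁻¹ · c x (π g⁻¹) · y₂` for `x ∈ Γ_S ∩ N`, `y₂ = pr₂ (ρ g⁻¹ (1,1))`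
  have hχ_conj : ∀ (g x : Γ) (hx : x ∈ A ⊓ N),
      χ ⟨g * x * g⁻¹, hN.conj_mem x hx.2 g⟩ =
        ((ρ g⁻¹ ((1 : Γ ⧸ N), (1 : H))).2)⁻¹ * c x (π g⁻¹) * (ρ g⁻¹ ((1 : Γ ⧸ N), (1 : H))).2 := by
    intro g x hx
    rw [hχ, map_mul ρ, map_mul ρ, Equiv.Perm.mul_apply, Equiv.Perm.mul_apply]
    set y := ρ g⁻¹ ((1 : Γ ⧸ N), (1 : H)) with hy
    have hy1 : y.1 = π g⁻¹ := by
      have h := hρ_fst g⁻¹ 1 1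
      rw [← hy, mul_one] at h
      exact h
    have hxy : ρ x y = (y.1, y.2 * (y.2⁻¹ * c x (π g⁻¹) * y.2)) := by
      rw [hρA x hx.1]
      change (π x * y.1, c x y.1 * y.2) = (y.1, y.2 * (y.2⁻¹ * c x (π g⁻¹) * y.2))
      rw [hπN.mpr hx.2, one_mul, hy1, ← mul_assoc, ← mul_assoc, mul_inv_cancel, one_mul]
    have hgy : ρ g y = ((1 : Γ ⧸ N), (1 : H)) := by
      rw [hy, ← Equiv.Perm.mul_apply, ← map_mul, mul_inv_cancel, map_one, Equiv.Perm.one_apply]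
    rw [hxy, hρ_snd g y.1 y.2, Prod.mk.eta, hgy]
    exact one_mul _
  have hfO : π f⁻¹ ∈ O := by
    rw [hO_iff, ← map_mul, inv_mul_cancel, map_one]
    exact one_mem _
  have hsf : s (π f⁻¹) ∈ A ⊓ N := by
    refine Subgroup.mem_inf.mpr ⟨hsA hfO, ?_⟩
    rw [← hπN, hsπ hfO, ← map_mul, inv_mul_cancel, map_one]
  refine ⟨χ, ((ρ f⁻¹ ((1 : Γ ⧸ N), (1 : H))).2)⁻¹ * (φ ⟨s (π f⁻¹), hsf⟩)⁻¹, fun x hx => ?_,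
    fun g hg x hx => ?_⟩
  · -- `χ (f x f⁻¹) = h φ(x) h⁻¹`
    rw [hχ_conj f x hx, hc_of_pos hx.1 hfO]
    have hmem : (s (π f⁻¹))⁻¹ * x * s (π f⁻¹) ∈ A ⊓ N :=
      (A ⊓ N).mul_mem ((A ⊓ N).mul_mem ((A ⊓ N).inv_mem hsf) hx) hsf
    have heq : (⟨(s (π x * π f⁻¹))⁻¹ * x * s (π f⁻¹), ht hx.1 hfO⟩ : ↥(A ⊓ N)) =
        ⟨s (π f⁻¹), hsf⟩⁻¹ * ⟨x, hx⟩ * ⟨s (π f⁻¹), hsf⟩ := by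
      apply Subtype.ext
      change (s (π x * π f⁻¹))⁻¹ * x * s (π f⁻¹) = (s (π f⁻¹))⁻¹ * x * s (π f⁻¹)
      rw [hπN.mpr hx.2, one_mul]
    rw [heq]
    simp only [map_mul, map_inv, mul_inv_rev, inv_inv, mul_assoc]
  · -- `χ (g x g⁻¹) = 1` off the orbit of `π f⁻¹`
    rw [hχ_conj g x hx]
    have hc1 : c x (π g⁻¹) = 1 := by
      refine hc_of_not fun hgO => hg ?_
      have h1 : π (g⁻¹ * f) ∈ Abar := by rw [map_mul]; exact hgO
      obtain ⟨a, ha, n, hn, h⟩ := Set.mem_mul.mp (hAN.mp h1)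
      rw [← normal_coe_mul_comm A N]
      refine Set.mem_mul.mpr ⟨n⁻¹, N.inv_mem hn, a⁻¹, A.inv_mem ha, ?_⟩
      rw [← mul_inv_rev, h, mul_inv_rev, inv_inv]
    rw [hc1, mul_one, inv_mul_cancel]

/-- **Separating normal subgroup from a nonabelian homomorphism of the factor's level** ([CombGC]
Prop. 1.2, proof p. 9, discrete form with nonabelian monodromy).  `Γ` free with basis `b`, `Γ_S = ⟨b(S)⟩`,
`N ⊴ Γ`, `H` a FINITE group, `φ : Γ_S ∩ N → H`, `f ∈ Γ`: there is `U ⊴ N` with `[N : U] ∣ |H|`,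
`f x f⁻¹ ∈ U ↔ φ(x) = 1` for `x ∈ Γ_S ∩ N`, and `g (Γ_S ∩ N) g⁻¹ ⊆ U` whenever `f⁻¹ g ∉ Γ_S·N`.
[cite: MochizukiCombGC2007, Prop 1.2 proof p.9] -/
theorem exists_normal_separating_of_freeFactor_hom (b : FreeGroupBasis β Γ) (S : Set β)
    (A : Subgroup Γ) (hA : A = Subgroup.closure (b '' S)) (N : Subgroup Γ) [hN : N.Normal]
    {H : Type*} [Group H] [Finite H] (φ : ↥(A ⊓ N) →* H) (f : Γ) :
    ∃ U : Subgroup N, U.Normal ∧ U.index ∣ Nat.card H ∧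
      (∀ (x : Γ) (hx : x ∈ A ⊓ N), (⟨f * x * f⁻¹, hN.conj_mem x hx.2 f⟩ : N) ∈ U ↔ φ ⟨x, hx⟩ = 1) ∧
      ∀ g : Γ, f⁻¹ * g ∉ (A : Set Γ) * (N : Set Γ) →
        ConjAct.toConjAct g • (A ⊓ N) ≤ U.map N.subtype := by
  classical
  obtain ⟨χ, h, hχf, hχg⟩ := exists_hom_extension_of_freeFactor b S A hA N φ f
  refine ⟨χ.ker, inferInstance, ?_, fun x hx => ?_, fun g hg z hz => ?_⟩
  · rw [Subgroup.index_ker]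
    exact Subgroup.card_subgroup_dvd_card χ.range
  · rw [MonoidHom.mem_ker, hχf x hx]
    constructor
    · intro h1
      have h2 : φ ⟨x, hx⟩ = h⁻¹ * (h * φ ⟨x, hx⟩ * h⁻¹) * h := by group
      rw [h2, h1]
      group
    · intro h1
      rw [h1, mul_one, mul_inv_cancel]
  · obtain ⟨x, hxB, rfl⟩ := (Subgroup.mem_smul_pointwise_iff_exists _ _ _).mp hz
    rw [ConjAct.smul_def, ConjAct.ofConjAct_toConjAct]
    exact Subgroup.mem_map.mpr ⟨⟨g * x * g⁻¹, hN.conj_mem x hxB.2 g⟩,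
      by rw [MonoidHom.mem_ker]; exact hχg g hg x hxB, rfl⟩

end FreeFactorFibredTwistNonabelian

end Literature.GroupTheory.CombinatorialGroupTheory
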